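import Summits.QuantumFields.BalabanUV.T4Continuum.Support.ShellMeasureTranslate
import Literature.MathematicalPhysics.QuantumFieldTheory.Balaban1983to89.T4ShellMeasureDet

/-!
# `T4Continuum.ShellMeasureTranslateBond` — member (τ) of the NE7c shell-measure frame over the REALIZED
# configuration space: the one-bond left translation preserves product Haar (S1), sparsity of the grid translates
# from the exit along a one-parameter subgroup (S2), forward comparison from a log-Lipschitz rate (S3), and the member
# end to end with its located inputs as binders (S4)
# (cell `pub-balaban`, sub-cell `t4`, spine estimate NE7c (node U5b); EXECUTOR: lineage t4-ne7c-p1 = PROVER seat P1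
# «shell-measure route», generation 21, row-NE7c owner, carrying out steps S1–S4 of the NE7 ideation memo
# `HOME/t4/b2b-balaban-t4-ne7-p2/g25/IDEAS-NE7-g25.md` 6964dd430aaf9a72 (lineage t4-ne7-p2, gen 25); tree target
# `Summits/QuantumFields/BalabanUV/T4Continuum/Support/`; ADDITIVE — imports `Support.ShellMeasureTranslate` (the
# engine) + `T4ShellMeasureDet` (the realized vocabulary) and modifies nothing)

HONEST FRAMING.  Finite four-torus programme, rung (B)+1 only — NOT infinite volume, NOT a mass gap, NOT the Clay
problem, NOT summit progress; (B), `BetaPertHyp`, (B^μ) are not mentioned because nothing here consumes them.  The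
cell wall of NE7c — (M1) `T4ShellMeasure.SlotAntiConcentration` FOR BAŁABAN'S INDUCTIVELY DEFINED EFFECTIVE MEASURES —
is NOT PRINTED in [Balaban 1983–89] (GAPS G-ne7cp1-1), asserted by nobody, and NOT moved by this file: a SECOND
member is typed beside the local dilation (γ_loc) (`T4ShellMeasureLocal` ∕ `T4ShellMeasureDet` ∕
`Support.ShellMeasureScaling{,Local,SU2}`), with a DISJOINT located input — the one-sided transversality (T1) — so
that the two members fail independently.  Every declaration is [folklore] kernel mathematics, 0 sorry, 0 citations;
NOTHING of Bałaban's densities, minimisers or response kernels is asserted — they enter as the hypotheses below.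

THE MEMBER (τ) (memo §1, dictionary; readings → the hypotheses of §3).  Move ONE block bond `b₀` by LEFT
TRANSLATION `U ↦ U[b₀ := γ(s)·U(b₀)]` along a one-parameter subgroup `γ` of `G` (§1 `bondMul`,
`measurePreserving_bondMul`: a measurable automorphism of the configuration space PRESERVING product Haar —
Jacobian ≡ 1, no chart, no passage through the flat point).  The shell `{θ(1−ρ) ≤ u < θ}` is cut into finitely many
pieces `S m` by an ASSIGNMENT `m = (nearby bond, signed Lie-algebra direction)` read off the active plaquette of the
sup-type tested variable `u` (binders `hSsh`, `hcover`).  Along the orbit of a point of `S m` the ACTIVE plaquette's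
functional `gAct m x` obeys the ONE-SIDED expansion `g(s) ≥ g(0) + κ s − C₂ s²` on `[0, s₁]` ((T1)+(T1′), binder
`hexp`), starts at `u x` (`hact`) and is dominated by `u` along the orbit (`hdom`: a sup is ≥ its active member), so
the orbit LEAVES THE SHELL UPWARDS within `ℓ = 2ρθ/κ` and stays above on `[ℓ, ℓ + w]`; hence every configuration is
reached from `S m` by at most `⌊ℓ/δ⌋ + 1` of the `k` grid translates `γ(iδ)` spanning `(k−1)δ ≤ ℓ + w` (§2
`sparse_of_exit`).  The density is forward log-Lipschitz along the bond flow with rate `Λ` over `[0, ℓ + w]`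
((T2)+(T4), binder `hLip`; §3 `mono_of_fwdLipschitz`: comparison constant `e^{Λ(ℓ+w)}`).  The engine then gives
(M1) `SlotAntiConcentration ((fieldMeasure P j G).withDensity F) u θ ρ D` with
`D = |M|·(e^{Λ(ℓ+w)}·(⌊ℓ/δ⌋+1)/k)/ρ` (§3 `slotAntiConcentration_realized_oneBond`) — for the finest admissible grids
`≈ |M|·e^{Λ(ℓ+w)}·ℓ/((ℓ+w)ρ) ≤ 2|M|e^{Λ(ℓ+w)}θ/(κ w)`, the memo's `D_k`.  Co-tests ∕ mass ratio ride as in (γ_loc)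
((SS′)∕(MR), `T4ShellMeasureLocal` §5) and are not repeated here.

LOCATED, NOT PRINTED (the binders of §3): (T1)∕(T1′) `hexp` — a LOWER bound `κ` on the response of the active
plaquette variable to the best nearby bond, the member's only non-degeneracy input (heuristic of printed KINDS in
the memo: reproduction of constant curvature by the linearised constrained minimiser + exponential decay of the
response kernel + Cauchy from B11 Prop. 9; falsifier = the memo's kit job); (T2)+(T4) `hLip` — the forward
log-Lipschitz rate `Λ` of the sectioned density along one bond (printed TYPE (2.23) ∕ B12 + Cauchy; the same
first-order action-derivative quantity as `ℓ_j` of GAPS G-ne7cp1-22, so both members size the slot constant as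
`≈ A₀²p₀(g_j)² × polylog`); the assignment `S`, `hSsh`, `hcover` with its measurability; `hact` ∕ `hdom`.
NE7c NOT proved.
-/

namespace Summit.QuantumFields.BalabanUV.T4Continuum.ShellMeasureTranslateBond

open MeasureTheory Set Function Finset
open scoped ENNReal
open Literature.MathematicalPhysics.QuantumFieldTheory.Balaban1983to89
open T4ShellMeasure (SlotAntiConcentration)
open ShellMeasureTranslate (gap_of_exit grid_count_le exit_above slotAntiConcentration_of_translates)

/-! ## §1 (S1) The one-bond left translation: a measure-preserving automorphism of product Haar -/

section OneBond

variable {P : Params} {j : ℕ} {G : Type*} [GaugeGroup G] [MeasurableSpace G] [MeasurableMul G]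
  [DecidableEq (PBond P j)]

/-- the one-bond left translation as a plain map: `U ↦ U[b₀ := g·U(b₀)]`. [folklore] -/
def bondMulFun (b₀ : PBond P j) (g : G) (U : GaugeField P j G) : GaugeField P j G :=
  fun b => if b = b₀ then g * U b else U b

omit [MeasurableSpace G] [MeasurableMul G] in
/-- translating by `g` then by `h` on the same bond is translating by `h·g`. [folklore] -/
theorem bondMulFun_bondMulFun (b₀ : PBond P j) (g h : G) (U : GaugeField P j G) :
    bondMulFun b₀ h (bondMulFun b₀ g U) = bondMulFun b₀ (h * g) U := by
  funext b
  by_cases hb : b = b₀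
  · simp only [bondMulFun, if_pos hb, mul_assoc]
  · simp only [bondMulFun, if_neg hb]

omit [MeasurableSpace G] [MeasurableMul G] in
/-- translating by `1` is the identity. [folklore] -/
theorem bondMulFun_one (b₀ : PBond P j) (U : GaugeField P j G) : bondMulFun b₀ (1 : G) U = U := by
  funext b
  by_cases hb : b = b₀
  · simp only [bondMulFun, if_pos hb, one_mul]
  · simp only [bondMulFun, if_neg hb]

/-- the one-bond left translation is measurable (product σ-algebra; `MeasurableMul G`). [folklore] -/
theorem measurable_bondMulFun (b₀ : PBond P j) (g : G) :
    Measurable (bondMulFun b₀ g : GaugeField P j G → GaugeField P j G) := by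
  refine measurable_pi_lambda _ fun b => ?_
  by_cases hb : b = b₀
  · simp only [bondMulFun, if_pos hb]
    exact (measurable_pi_apply (X := fun _ : PBond P j => G) b).const_mul g
  · simp only [bondMulFun, if_neg hb]
    exact measurable_pi_apply b

/-- **THE ONE-BOND LEFT TRANSLATION `U ↦ U[b₀ := g·U(b₀)]` AS A MEASURABLE AUTOMORPHISM** of the configuration
space (inverse: translation by `g⁻¹`). [folklore] -/
def bondMul (b₀ : PBond P j) (g : G) : GaugeField P j G ≃ᵐ GaugeField P j G where
  toFun := bondMulFun b₀ g
  invFun := bondMulFun b₀ g⁻¹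
  left_inv U := by
    show bondMulFun b₀ g⁻¹ (bondMulFun b₀ g U) = U
    rw [bondMulFun_bondMulFun, inv_mul_cancel, bondMulFun_one]
  right_inv U := by
    show bondMulFun b₀ g (bondMulFun b₀ g⁻¹ U) = U
    rw [bondMulFun_bondMulFun, mul_inv_cancel, bondMulFun_one]
  measurable_toFun := measurable_bondMulFun b₀ g
  measurable_invFun := measurable_bondMulFun b₀ g⁻¹

/-- `bondMul b₀ g U` moves the bond `b₀` by `g` on the left … [folklore] -/
@[simp] theorem bondMul_apply_self (b₀ : PBond P j) (g : G) (U : GaugeField P j G) :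
    bondMul b₀ g U b₀ = g * U b₀ := by
  show bondMulFun b₀ g U b₀ = g * U b₀
  simp only [bondMulFun, if_true]

/-- … and no other bond. [folklore] -/
@[simp] theorem bondMul_apply_of_ne {b₀ b : PBond P j} (hb : b ≠ b₀) (g : G) (U : GaugeField P j G) :
    bondMul b₀ g U b = U b := by
  show bondMulFun b₀ g U b = U b
  simp only [bondMulFun, if_neg hb]

/-- composition of one-bond translations is the translation by the product. [folklore] -/
theorem bondMul_bondMul (b₀ : PBond P j) (g h : G) (U : GaugeField P j G) :
    bondMul b₀ g (bondMul b₀ h U) = bondMul b₀ (g * h) U := by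
  funext b
  by_cases hb : b = b₀
  · subst hb; simp only [bondMul_apply_self, mul_assoc]
  · simp only [bondMul_apply_of_ne hb]

/-- translation by `1` is the identity. [folklore] -/
theorem bondMul_one (b₀ : PBond P j) (U : GaugeField P j G) : bondMul b₀ (1 : G) U = U := by
  funext b
  by_cases hb : b = b₀
  · subst hb; simp only [bondMul_apply_self, one_mul]
  · simp only [bondMul_apply_of_ne hb]

/-- the inverse translation. [folklore] -/
theorem bondMul_symm_apply (b₀ : PBond P j) (g : G) (U : GaugeField P j G) :
    (bondMul b₀ g).symm U = bondMul b₀ g⁻¹ U := rfl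

variable [HaarData G]

/-- **(S1) THE ONE-BOND LEFT TRANSLATION PRESERVES PRODUCT HAAR** (`HaarData.map_mul_left` on the moved factor,
identity on the others; `measurePreserving_pi`): Jacobian ≡ 1. [folklore] -/
theorem measurePreserving_bondMul (b₀ : PBond P j) (g : G) :
    MeasurePreserving (bondMul b₀ g) (fieldMeasure P j G) (fieldMeasure P j G) := by
  haveI : IsProbabilityMeasure (HaarData.haar : Measure G) := HaarData.isProb
  have h := measurePreserving_pi (fun _ : PBond P j => (HaarData.haar : Measure G))
    (fun _ : PBond P j => (HaarData.haar : Measure G))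
    (f := fun b => if b = b₀ then (fun x : G => g * x) else id) fun b => by
      by_cases hb : b = b₀
      · simp only [if_pos hb]
        exact ⟨measurable_const_mul g, HaarData.map_mul_left g⟩
      · simp only [if_neg hb]
        exact MeasurePreserving.id _
  refine ⟨(bondMul b₀ g).measurable, ?_⟩
  have hfun : (fun (a : GaugeField P j G) (b : PBond P j) =>
      (if b = b₀ then (fun x : G => g * x) else id) (a b)) = bondMul b₀ g := by
    funext U b
    by_cases hb : b = b₀
    · rw [if_pos hb, hb, bondMul_apply_self]
    · rw [if_neg hb, bondMul_apply_of_ne hb]; rfl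
  rw [← hfun]
  unfold fieldMeasure
  exact h.map_eq

end OneBond

/-! ## §2 (S2) Sparsity from the exit: the flow along a one-parameter subgroup, the orbit visit set, the grid -/

section Flow

variable {P : Params} {j : ℕ} {G : Type*} [GaugeGroup G] [MeasurableSpace G] [MeasurableMul G]
  [DecidableEq (PBond P j)]

/-- the flow property of the translates along a one-parameter subgroup `γ` (`γ(s+t) = γ(s)γ(t)`). [folklore] -/
theorem bondMul_flow {γ : ℝ → G} (hγ : ∀ s t, γ (s + t) = γ s * γ t) (b₀ : PBond P j) (s t : ℝ)
    (U : GaugeField P j G) : bondMul b₀ (γ s) (bondMul b₀ (γ t) U) = bondMul b₀ (γ (s + t)) U := by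
  rw [bondMul_bondMul, hγ]

/-- the inverse translate along a one-parameter subgroup is the translate by the opposite parameter. [folklore] -/
theorem bondMul_symm_flow {γ : ℝ → G} (hγ : ∀ s t, γ (s + t) = γ s * γ t) (hγ0 : γ 0 = 1) (b₀ : PBond P j)
    (s : ℝ) (U : GaugeField P j G) : (bondMul b₀ (γ s)).symm U = bondMul b₀ (γ (-s)) U := by
  rw [bondMul_symm_apply]
  have hinv : (γ s)⁻¹ = γ (-s) := by
    rw [inv_eq_iff_mul_eq_one, ← hγ, add_neg_cancel, hγ0]
  rw [hinv]

/-- **SPARSITY OF THE GRID TRANSLATES FROM THE EXIT.**  Piece `S ⊆ {u < θ}`; along the flow from every point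
`x ∈ S` reached on an orbit, the tested variable is `≥ θ` on the window `[ℓ, ℓ + w]` (`hexit`, = `exit_above` per
orbit); then every configuration `y` is reached from `S` by at most `⌊ℓ/δ⌋ + 1` of the `k` grid translates
`bondMul b₀ (γ(i δ))`, `i < k`, provided the grid spans `(k − 1)δ ≤ ℓ + w`. [folklore] -/
theorem sparse_of_exit {γ : ℝ → G} (hγ : ∀ s t, γ (s + t) = γ s * γ t) (hγ0 : γ 0 = 1) (b₀ : PBond P j)
    {S : Set (GaugeField P j G)} {u : GaugeField P j G → ℝ} {θ ℓ w δ : ℝ} {k : ℕ} (hδ : 0 < δ) (hℓ : 0 ≤ ℓ)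
    (hspan : ((k : ℝ) - 1) * δ ≤ ℓ + w) (hSθ : S ⊆ {x | u x < θ})
    (hexit : ∀ x ∈ S, ∀ t, ℓ ≤ t → t ≤ ℓ + w → θ ≤ u (bondMul b₀ (γ t) x)) (y : GaugeField P j G) :
    ∑ i : Fin k, ((bondMul b₀ (γ ((i : ℕ) * δ))).symm ⁻¹' S).indicator (fun _ => (1 : ℝ≥0∞)) y ≤
      (⌊ℓ / δ⌋₊ + 1 : ℕ) := by
  classical
  -- the orbit visit set of `y`, parametrised so that the translate `i` reads the orbit at `s₀ + (k-1-i)δ`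
  set A : Set ℝ := {t | bondMul b₀ (γ t) y ∈ S} with hA
  have hvis : A ⊆ {t | u (bondMul b₀ (γ t) y) < θ} := fun t ht => hSθ ht
  have hgap : ∀ a ∈ A, ∀ t, a + ℓ ≤ t → t ≤ a + ℓ + w → t ∉ A := by
    refine gap_of_exit hvis fun a ha t h1 h2 => ?_
    have h := hexit _ ha (t - a) (by linarith) (by linarith)
    rwa [bondMul_flow hγ, show t - a + a = t by ring] at h
  -- count: the indicator sum is the number of grid points of the orbit in `A`
  have hcount : ∑ i : Fin k, ((bondMul b₀ (γ ((i : ℕ) * δ))).symm ⁻¹' S).indicator (fun _ => (1 : ℝ≥0∞)) y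
      = ((Finset.univ.filter (fun i : Fin k => -((i : ℕ) : ℝ) * δ ∈ A)).card : ℝ≥0∞) := by
    rw [← sum_boole]
    refine sum_congr rfl fun i _ => ?_
    have hmem : y ∈ (bondMul b₀ (γ ((i : ℕ) * δ))).symm ⁻¹' S ↔ -((i : ℕ) : ℝ) * δ ∈ A := by
      rw [Set.mem_preimage, bondMul_symm_flow hγ hγ0, hA, Set.mem_setOf_eq, neg_mul]
    by_cases h : -((i : ℕ) : ℝ) * δ ∈ A
    · rw [indicator_of_mem (hmem.2 h), if_pos h]
    · rw [indicator_of_notMem (mt hmem.1 h), if_neg h]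
  rw [hcount]
  -- re-index the grid `-(i δ)`, `i < k`, as `s₀ + i' δ` with `s₀ = -(k-1)δ`, `i' = k - 1 - i`
  have hinj : (Finset.univ.filter (fun i : Fin k => -((i : ℕ) : ℝ) * δ ∈ A)).card ≤
      ((range k).filter (fun i : ℕ => -(((k : ℝ) - 1) * δ) + (i : ℝ) * δ ∈ A)).card := by
    apply Finset.card_le_card_of_injOn (fun i : Fin k => k - 1 - (i : ℕ))
    · intro i hi
      rw [Finset.mem_coe, mem_filter] at hi ⊢
      have hik : (i : ℕ) + 1 ≤ k := i.2
      refine ⟨mem_range.2 (show k - 1 - (i : ℕ) < k by omega), ?_⟩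
      have e : -(((k : ℝ) - 1) * δ) + ((k - 1 - (i : ℕ) : ℕ) : ℝ) * δ = -((i : ℕ) : ℝ) * δ := by
        rw [Nat.cast_sub (by omega), Nat.cast_sub (by omega)]
        push_cast
        ring
      rw [e]
      exact hi.2
    · intro a ha b hb hab
      have ha' : (a : ℕ) < k := a.2
      have hb' : (b : ℕ) < k := b.2
      have hab' : k - 1 - (a : ℕ) = k - 1 - (b : ℕ) := hab
      exact Fin.ext (show (a : ℕ) = (b : ℕ) by omega)
  have hgrid := grid_count_le (A := A) (s₀ := -(((k : ℝ) - 1) * δ)) (m := k) hδ hℓ hgap hspan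
  exact_mod_cast hinj.trans hgrid

end Flow

/-! ## §3 (S3)+(S4) The member end to end over the realized configuration space -/

section Member

variable {P : Params} {j : ℕ} {G : Type*} [GaugeGroup G] [MeasurableSpace G] [MeasurableMul G]
  [DecidableEq (PBond P j)]

/-- (S3) forward comparison along the grid from a forward log-Lipschitz rate `Λ` of the density along the bond flow
over the range `[0, R]`: constant `e^{Λ R}`. [folklore] -/
theorem mono_of_fwdLipschitz {γ : ℝ → G} (b₀ : PBond P j) {F : GaugeField P j G → ℝ≥0∞}
    {S : Set (GaugeField P j G)} {Λ R δ : ℝ} {k : ℕ} (hΛ : 0 ≤ Λ) (hδ : 0 ≤ δ) (hspan : ((k : ℝ) - 1) * δ ≤ R)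
    (hLip : ∀ x ∈ S, ∀ s, 0 ≤ s → s ≤ R → F x ≤ ENNReal.ofReal (Real.exp (Λ * s)) * F (bondMul b₀ (γ s) x))
    (i : Fin k) : ∀ x ∈ S, F x ≤ ENNReal.ofReal (Real.exp (Λ * R)) * F (bondMul b₀ (γ ((i : ℕ) * δ)) x) := by
  intro x hx
  have hik : ((i : ℕ) : ℝ) ≤ (k : ℝ) - 1 := by
    have : (i : ℕ) + 1 ≤ k := i.2
    have h' : ((i : ℕ) : ℝ) + 1 ≤ (k : ℝ) := by exact_mod_cast this
    linarith
  have hs0 : 0 ≤ ((i : ℕ) : ℝ) * δ := mul_nonneg (Nat.cast_nonneg _) hδ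
  have hsR : ((i : ℕ) : ℝ) * δ ≤ R := (mul_le_mul_of_nonneg_right hik hδ).trans hspan
  refine (hLip x hx _ hs0 hsR).trans (mul_le_mul_of_nonneg_right ?_ bot_le)
  exact ENNReal.ofReal_le_ofReal (Real.exp_le_exp.2 (mul_le_mul_of_nonneg_left hsR hΛ))

variable [HaarData G]

/-- **MEMBER (τ) END TO END OVER THE REALIZED CONFIGURATION SPACE.**  Data: a finite MENU `M` with, for every item
`m`, a moved bond `bd m` and a one-parameter subgroup `γ m` of `G`; pieces `S m` (the shell points assigned to `m`,
measurable, inside the shell, covering it — `hSsh`, `hcover`, (S4)); grid mesh `δ > 0` and `k ≥ 1` translates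
spanning `(k−1)δ ≤ ℓ + w`, `ℓ = 2ρθ/κ`.  ANALYTIC BINDERS (located, NOT PRINTED): `hexp` — along the flow from every
`x ∈ S m` the ACTIVE functional `gAct m x` has the one-sided expansion with constants `κ > 0`, `C₂` on `[0, s₁]`
((T1)+(T1′)), with `hact` (`gAct m x 0 = u x`: at the start the active plaquette IS the sup) and `hdom` (a sup
dominates its member along the orbit), the window fitting `ℓ + w ≤ s₁`, `C₂(ℓ + w) ≤ κ/2`; `hLip` — the realized
density `F` is forward log-Lipschitz with rate `Λ ≥ 0` along the flow over `[0, ℓ + w]` ((T2)+(T4)).  CONCLUSION: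
(M1) `SlotAntiConcentration ((fieldMeasure P j G).withDensity F) u θ ρ D` with
`D = |M|·(e^{Λ(ℓ+w)}·(⌊ℓ/δ⌋+1)/k)/ρ`. [folklore] -/
theorem slotAntiConcentration_realized_oneBond {M : Type*} [Fintype M] (bd : M → PBond P j) {γ : M → ℝ → G}
    (hγ : ∀ m s t, γ m (s + t) = γ m s * γ m t) (hγ0 : ∀ m, γ m 0 = 1)
    {F : GaugeField P j G → ℝ≥0∞} (hF : Measurable F) {u : GaugeField P j G → ℝ}
    {θ ρ κ C₂ s₁ w Λ δ : ℝ} {k : ℕ} (hθ : 0 ≤ θ) (hρ : 0 < ρ) (hκ : 0 < κ) (hΛ : 0 ≤ Λ) (hδ : 0 < δ) (hk : 0 < k)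
    (hws : 2 * ρ * θ / κ + w ≤ s₁) (hwC : C₂ * (2 * ρ * θ / κ + w) ≤ κ / 2) (hC₂ : 0 ≤ C₂)
    (hspan : ((k : ℝ) - 1) * δ ≤ 2 * ρ * θ / κ + w)
    (S : M → Set (GaugeField P j G)) (hSm : ∀ m, MeasurableSet (S m))
    (hSsh : ∀ m, S m ⊆ {x | θ * (1 - ρ) ≤ u x ∧ u x < θ})
    (hcover : {x | θ * (1 - ρ) ≤ u x ∧ u x < θ} ⊆ ⋃ m, S m)
    (gAct : M → GaugeField P j G → ℝ → ℝ) (hact : ∀ m, ∀ x ∈ S m, gAct m x 0 = u x)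
    (hdom : ∀ m, ∀ x ∈ S m, ∀ s, gAct m x s ≤ u (bondMul (bd m) (γ m s) x))
    (hexp : ∀ m, ∀ x ∈ S m, ∀ s, 0 ≤ s → s ≤ s₁ → gAct m x 0 + κ * s - C₂ * s ^ 2 ≤ gAct m x s)
    (hLip : ∀ m, ∀ x ∈ S m, ∀ s, 0 ≤ s → s ≤ 2 * ρ * θ / κ + w →
      F x ≤ ENNReal.ofReal (Real.exp (Λ * s)) * F (bondMul (bd m) (γ m s) x)) :
    SlotAntiConcentration ((fieldMeasure P j G).withDensity F) u θ ρ
      (Fintype.card M * (Real.exp (Λ * (2 * ρ * θ / κ + w)) * (⌊(2 * ρ * θ / κ) / δ⌋₊ + 1 : ℕ) /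
        Fintype.card (Fin k)) / ρ) := by
  set ℓ := 2 * ρ * θ / κ with hℓdef
  have hℓ0 : 0 ≤ ℓ := div_nonneg (by positivity) hκ.le
  have hkpos : 0 < Fintype.card (Fin k) := by rwa [Fintype.card_fin]
  refine slotAntiConcentration_of_translates (fieldMeasure P j G) hF u (Real.exp_pos _).le hρ _ hkpos S hSm
    (fun m (i : Fin k) => bondMul (bd m) (γ m ((i : ℕ) * δ))) (fun m i => measurePreserving_bondMul _ _) hcover
    (fun m i => mono_of_fwdLipschitz (bd m) hΛ hδ.le hspan (hLip m) i) fun m y => ?_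
  -- sparsity of piece `m` from the exit along the flow of item `m`
  refine sparse_of_exit (hγ m) (hγ0 m) (bd m) hδ hℓ0 hspan (fun x hx => (hSsh m hx).2)
    (fun x hx t ht1 ht2 => ?_) y
  have hstart : θ * (1 - ρ) ≤ gAct m x 0 := by rw [hact m x hx]; exact (hSsh m hx).1
  have hρθ : 0 ≤ ρ * θ := mul_nonneg hρ.le hθ
  exact exit_above (u := fun s => u (bondMul (bd m) (γ m s) x)) hκ hρθ (hexp m x hx) hstart (hdom m x hx) t
    ht1 (ht2.trans hws) ((mul_le_mul_of_nonneg_left ht2 hC₂).trans hwC)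

end Member

end Summit.QuantumFields.BalabanUV.T4Continuum.ShellMeasureTranslateBond
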